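import Summits.QuantumFields.YangMills.Theorems.UnitScaleTiltProp7TwistedSliceGaugeOntoSU2
import Summits.QuantumFields.YangMills.Theorems.UnitScaleTiltProp7QTwSCentralTowerRows
import HarnessLib

/-!
# Route `UnitScaleTilt`, crux K1 child «MinimiserStabilityRegPr» (stmt-QuantumFields-19200), skeleton v10, stub `stub_existenceMinimalOrbit` (EX), route (α) — **(R-T5) WITH NO DISPLAYED
# TOWER ROW: the `1∕8` rows `hWl`∕`hT` of ✓`exists_su2_slice_tangent_add_gaugeDir_of_complex` (loops and twisted stairs of the perturbed covariant tower of `e^{A₁}U₀`) HOLD at every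
# `U₀ ∈ 𝔘_k(ε₀)` and every `A` in the ball `‖A‖ < e·η` (`10⁹L²e ≤ 1`, `10¹²L³ε₀ ≤ 1`)** — the explicit-radius twin of ★w5-20520 g5's ✓`Prop7SymAvgTwSym.towerRows_of_regPr` (whose `∃ ρ`
# hides the radius `η∕(10⁹L²) ≥ e·η`; same proof, same suppliers) — hence **the reality of the (P1) pair of `hSplitD` UNCONDITIONALLY at printed-regular backgrounds**:
# ★★★`exists_su2_slice_tangent_add_gaugeDir_of_complex_of_regPr`.

Cell `ym3-torus`, width seat `ym-ust-20520-w4` (gen 6).  THEOREMS ONLY (0 `def`, 0 `sorry`).  `--supports stmt-QuantumFields-19200 --as helper`, count-neutral.  YM₃ on T³ is a ladder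
rung (R3), not the Clay problem; nothing here claims the stub, the crux, d = 4 or the mass gap.

THE SUPPLIERS (all ✓, ★w5-20520 g5 `…QTwSCentralTowerRows`): the perturbed covariant tower is bondwise within `r := 3(2e + 2700Lε₀) ≤ ½` of the background tower RELATIVELY
(✓`norm_dbarCovIterU_rel_sub_one_le_of_regPr`), the background tower is `U1`-valued (✓`emlIterU_bgUnits_mem_U1_of_regPr`) with loops `≤ 1∕16` (✓`loopHolU_emlIterU_bgUnits_le_sixteenth_of_regPr`),
and holonomies along loop∕stair words of two bondwise `2r`-close fields, one of them `U1`-valued, differ by `≤ 2ℓ·2r ≤ 1∕16` (✓`norm_loopHolU_sub_one_le_of_rel`, ✓`norm_tstairU_sub_one_le_of_rel`).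

WHAT IS PROVED (sorry-free, no definition; ns `…Theorems.Prop7TwistedSliceGaugeOntoSU2`):
★★`towerRows_at_of_regPr (hε₀ he hWe hWε) (U₀) (hreg) {A} (hA : ‖A‖ < e * eta F n K)` — both `1∕8` rows at `A`; ★★★`exists_su2_slice_tangent_add_gaugeDir_of_complex_of_regPr` — the sibling's
title theorem with `hWl`∕`hT` DISCHARGED (binders: windows, `hreg`, `hA₁`, `hA₁R`, `U′`, `ξ` `𝔰𝔲(2)`-valued, the complex pair `(β, N)` with its two rows; conclusion VERBATIM).
HONEST SCOPE.  Numerics + landed tower letters; (P2), the complex (P1) solver (T5) and its own closeness rows are NOT here; nothing of `hSplitD`, EX, the crux, N06(d = 3) or the gap is proved.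

References: T. Bałaban, CMP **98** (1985) 17–51 [Balaban1985Averaging] ((89)–(92) p.31, (161)–(163) p.42); CMP **109** (1987) 249–301 [Balaban1987RG1] ((0.3)–(0.4) pp.252–253);
CMP **102** (1985) 277–309 [Balaban1985Variational] ((51) p.286, (82)–(83) p.290).
-/

set_option autoImplicit false

noncomputable section

open scoped BigOperators Matrix Matrix.Norms.L2Operator Topology
open Filter Metric Set NormedSpace

namespace Summit.QuantumFields.YangMills.Theorems.Prop7TwistedSliceGaugeOntoSU2

open Literature.Analysis.Calculus.ExpDifferential (ad gSer)
open Literature.MathematicalPhysics.QuantumFieldTheory.Balaban1983to89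
open Literature.MathematicalPhysics.QuantumFieldTheory.Balaban1983to89.T3ContinuumYM3Torus
open T4Continuum BlockAveraging ExpMeanLog
open B7Prop1Explicit (expUnit U1)
open T3PrintedRegularMinimiser (RegPr)
open T3SectALandauChart (eta eta_pos bgUnits)
open Summit.QuantumFields.YangMills.Theorems.Prop8Chart (loopHolU emlIterU)
open Summit.QuantumFields.YangMills.Theorems.Prop7SymAvgTwSym (tstairU dbarCovIterU logChartTwS norm_loopHolU_sub_one_le_of_rel norm_tstairU_sub_one_le_of_rel norm_sub_le_of_rel
  norm_inv_sub_inv_le_of_rel emlIterU_bgUnits_mem_U1_of_regPr loopHolU_emlIterU_bgUnits_le_sixteenth_of_regPr norm_dbarCovIterU_rel_sub_one_le_of_regPr)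
open Summit.QuantumFields.YangMills.Theorems.Prop7CmapTwInputs (norm_apply_le_of_mem_ball)

variable (F : T3Family) {n K : ℕ} (h : n ≤ K)

/-- ★★ **THE `1∕8` TOWER ROWS ON THE WHOLE BALL `‖A‖ < e·η`, EXPLICIT RADIUS**: at `U₀ ∈ 𝔘_k(ε₀)` (`10⁹L²e ≤ 1`, `10¹²L³ε₀ ≤ 1`), for every `A` with `‖A‖ < e·η` and every level
`j < K − n`, the (0.4) loop variables of the perturbed covariant tower `dbarCovIterU j U₀♭ (e^{A}U₀♭)` and its twisted stair transporters against `Ū₀♭ʲ` are within `1∕8` of `1` — the proof of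
✓`Prop7SymAvgTwSym.towerRows_of_regPr` (★w5-20520 g5) run at the given `e` instead of `(10⁹L²)⁻¹` (`2ℓ·2r ≤ 1∕16` from `10⁹Le ≤ 1`, `10¹²L²ε₀ ≤ 1`).
[cite: Balaban1985Averaging, (89)-(92) p.31, (161)-(163) p.42; Balaban1987RG1, (0.3)-(0.4) pp.252-253] -/
theorem towerRows_at_of_regPr {ε₀ e : ℝ} (hε₀ : 0 < ε₀) (he : 0 < e) (hWe : 10 ^ 9 * (F.L : ℝ) ^ 2 * e ≤ 1) (hWε : 10 ^ 12 * (F.L : ℝ) ^ 3 * ε₀ ≤ 1)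
    (U₀ : GaugeField (F.P K) 0 (Matrix.specialUnitaryGroup (Fin 2) ℂ)) (hreg : RegPr F n K ε₀ U₀)
    {A : PBond (F.P K) 0 → Matrix (Fin 2) (Fin 2) ℂ} (hA : ‖A‖ < e * eta F n K) :
    (∀ j, j < K - n → ∀ (c : PBond (F.P K) (j + 1)) (i : Idx (F.P K)),
        ‖((loopHolU (dbarCovIterU j (bgUnits F K U₀) (fun b => expUnit (A b) * bgUnits F K U₀ b)) c i : (Matrix (Fin 2) (Fin 2) ℂ)ˣ) : Matrix (Fin 2) (Fin 2) ℂ) - 1‖ ≤ 1 / 8) ∧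
    (∀ j, j < K - n → ∀ (y : Site (F.P K) (j + 1)) (i : Idx (F.P K)),
        ‖((tstairU (emlIterU j (bgUnits F K U₀)) (dbarCovIterU j (bgUnits F K U₀) (fun b => expUnit (A b) * bgUnits F K U₀ b)) y i : (Matrix (Fin 2) (Fin 2) ℂ)ˣ) :
          Matrix (Fin 2) (Fin 2) ℂ) - 1‖ ≤ 1 / 8) := by
  have hd : (F.P K).d = 3 := T3Family.P_d F K
  have hLL : ((F.P K).L : ℝ) = F.L := rfl
  have hL3 : 3 ≤ F.L := by obtain ⟨a, ha⟩ := F.hL.1; have := F.hL.2; omega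
  have hL1 : (1 : ℝ) ≤ F.L := by exact_mod_cast (show 1 ≤ F.L by omega)
  have hε7 : 10 ^ 7 * (F.L : ℝ) ^ 3 * ε₀ ≤ 1 := by
    have h1 : (0 : ℝ) ≤ (F.L : ℝ) ^ 3 * ε₀ := by positivity
    nlinarith
  have hℓ : ((((F.P K).d + 2) * (F.P K).L : ℕ) : ℝ) = 5 * (F.L : ℝ) := by
    rw [hd, ← hLL]; push_cast; ring
  -- the numerics: `r := 3(2e + 2700Lε₀) ≤ ½`, `δ := 2r`, `2ℓδ ≤ 1/16`
  set r : ℝ := 3 * (2 * e + 2700 * (F.L : ℝ) * ε₀) with hr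
  have hr0 : 0 ≤ r := by positivity
  have he9 : 10 ^ 9 * ((F.L : ℝ) * e) ≤ 1 := by
    have hL12 : (F.L : ℝ) ≤ (F.L : ℝ) ^ 2 := by nlinarith
    have : (F.L : ℝ) * e ≤ (F.L : ℝ) ^ 2 * e := mul_le_mul_of_nonneg_right hL12 he.le
    nlinarith
  have hLε : 10 ^ 12 * ((F.L : ℝ) ^ 2 * ε₀) ≤ 1 := by
    have : (F.L : ℝ) ^ 2 * ε₀ ≤ (F.L : ℝ) ^ 3 * ε₀ := mul_le_mul_of_nonneg_right (pow_le_pow_right₀ hL1 (by norm_num : 2 ≤ 3)) hε₀.le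
    linarith
  have hnum : 2 * ((((F.P K).d + 2) * (F.P K).L : ℕ) : ℝ) * (2 * r) ≤ 1 / 16 := by
    rw [hℓ, hr]
    have e1 : 2 * (5 * (F.L : ℝ)) * (2 * (3 * (2 * e + 2700 * (F.L : ℝ) * ε₀))) = 120 * ((F.L : ℝ) * e) + 162000 * ((F.L : ℝ) ^ 2 * ε₀) := by ring
    rw [e1]; nlinarith
  have hr2 : r ≤ 1 / 2 := by
    have hℓ1 : (1 : ℝ) ≤ 2 * ((((F.P K).d + 2) * (F.P K).L : ℕ) : ℝ) := by rw [hℓ]; linarith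
    nlinarith
  have hAb : ∀ b, ‖A b‖ ≤ e * eta F n K := norm_apply_le_of_mem_ball F hA
  -- per level: the background tower is `U1`-valued, the perturbed tower `r`-close to it relatively
  have hV : ∀ j, j < K - n → ∀ b : PBond (F.P K) j, emlIterU j (bgUnits F K U₀) b ∈ U1 (Matrix (Fin 2) (Fin 2) ℂ) :=
    fun j hj b => emlIterU_bgUnits_mem_U1_of_regPr F hε₀ hε7 hreg hj.le b
  have hrel : ∀ j, j < K - n → ∀ b : PBond (F.P K) j,
      ‖((dbarCovIterU j (bgUnits F K U₀) (fun b => expUnit (A b) * bgUnits F K U₀ b) b : (Matrix (Fin 2) (Fin 2) ℂ)ˣ) : Matrix (Fin 2) (Fin 2) ℂ) *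
          (((emlIterU j (bgUnits F K U₀) b)⁻¹ : (Matrix (Fin 2) (Fin 2) ℂ)ˣ) : Matrix (Fin 2) (Fin 2) ℂ) - 1‖ ≤ r :=
    fun j hj b => norm_dbarCovIterU_rel_sub_one_le_of_regPr F hε₀ he.le hWe hWε U₀ hreg A hAb hj.le b
  have h₁ : ∀ j, j < K - n → ∀ b : PBond (F.P K) j,
      ‖((dbarCovIterU j (bgUnits F K U₀) (fun b => expUnit (A b) * bgUnits F K U₀ b) b : (Matrix (Fin 2) (Fin 2) ℂ)ˣ) : Matrix (Fin 2) (Fin 2) ℂ) -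
          ((emlIterU j (bgUnits F K U₀) b : (Matrix (Fin 2) (Fin 2) ℂ)ˣ) : Matrix (Fin 2) (Fin 2) ℂ)‖ ≤ 2 * r :=
    fun j hj b => (norm_sub_le_of_rel (hV j hj b) (hrel j hj b)).trans (by linarith)
  have h₂ : ∀ j, j < K - n → ∀ b : PBond (F.P K) j,
      ‖(((dbarCovIterU j (bgUnits F K U₀) (fun b => expUnit (A b) * bgUnits F K U₀ b) b)⁻¹ : (Matrix (Fin 2) (Fin 2) ℂ)ˣ) : Matrix (Fin 2) (Fin 2) ℂ) -
          (((emlIterU j (bgUnits F K U₀) b)⁻¹ : (Matrix (Fin 2) (Fin 2) ℂ)ˣ) : Matrix (Fin 2) (Fin 2) ℂ)‖ ≤ 2 * r :=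
    fun j hj b => norm_inv_sub_inv_le_of_rel (hV j hj b) hr2 (hrel j hj b)
  have hδ0 : 0 ≤ 2 * r := by positivity
  have hℓδ : 2 * ((((F.P K).d + 2) * (F.P K).L : ℕ) : ℝ) * (2 * r) ≤ 1 := hnum.trans (by norm_num)
  refine ⟨fun j hj c i => ?_, fun j hj y i => ?_⟩
  · have h1 := norm_loopHolU_sub_one_le_of_rel _ _ hδ0 (hV j hj) (h₁ j hj) (h₂ j hj) hℓδ c i
    have h2 := loopHolU_emlIterU_bgUnits_le_sixteenth_of_regPr F hε₀ hε7 hreg j hj c i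
    linarith
  · exact (norm_tstairU_sub_one_le_of_rel _ _ hδ0 (hV j hj) (h₁ j hj) (h₂ j hj) hℓδ y i).trans (hnum.trans (by norm_num))

/-- ★★★ **THE (P1) PAIR OF `hSplitD` IS REAL, NO DISPLAYED TOWER ROW**: ✓`exists_su2_slice_tangent_add_gaugeDir_of_complex` with its `1∕8` rows `hWl`∕`hT` supplied by
`towerRows_at_of_regPr` at `A := A₁` (`‖A₁‖ < e·η`).  Inputs: the windows, `U₀ ∈ 𝔘_k(ε₀)`, an `𝔰𝔲(2)` chart point `A₁`, any `SU(2)` configuration `U′`, an `𝔰𝔲(2)`-valued `ξ`, and any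
complex pair `(β, N)` with `D(logChartTwS U₀)(A₁)β = 0`, `ξ = g(ad(−A₁))β + (N(b₋) − U′♭N(b₊)U′♭⁻¹)` (T5 (B)'s conclusion); output: `β′` `𝔰𝔲(2)`-valued with `D(…)(A₁)β′ = 0` and `N′` Hermitian
traceless with `ξ = g(ad(−A₁))β′ + (iN′(b₋) − U′(b)·iN′(b₊)·U′(b)⋆)`. [cite: Balaban1985Variational, (51) p.286, (82)-(83) p.290; Balaban1985BackgroundPropagators, (3.13)-(3.15) p.393] -/
theorem exists_su2_slice_tangent_add_gaugeDir_of_complex_of_regPr {ε₀ e : ℝ} (hε₀ : 0 < ε₀) (he : 0 < e) (hWe : 10 ^ 9 * (F.L : ℝ) ^ 2 * e ≤ 1)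
    (hWε : 10 ^ 12 * (F.L : ℝ) ^ 3 * ε₀ ≤ 1)
    (U₀ : GaugeField (F.P K) 0 (Matrix.specialUnitaryGroup (Fin 2) ℂ)) (hreg : RegPr F n K ε₀ U₀)
    {A₁ : PBond (F.P K) 0 → Matrix (Fin 2) (Fin 2) ℂ} (hA₁ : ‖A₁‖ < e * eta F n K) (hA₁R : ∀ b, star (A₁ b) = -A₁ b ∧ (A₁ b).trace = 0)
    (U' : GaugeField (F.P K) 0 (Matrix.specialUnitaryGroup (Fin 2) ℂ))
    (ξ : PBond (F.P K) 0 → Matrix (Fin 2) (Fin 2) ℂ) (hξ : ∀ b, star (ξ b) = -ξ b ∧ (ξ b).trace = 0)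
    (β : PBond (F.P K) 0 → Matrix (Fin 2) (Fin 2) ℂ) (N : Site (F.P K) 0 → Matrix (Fin 2) (Fin 2) ℂ)
    (hβ : fderiv ℂ (logChartTwS F n K h U₀) A₁ β = 0)
    (hsplit : ∀ b : PBond (F.P K) 0, ξ b = gSer ℂ (ad ℂ (-A₁ b)) (β b)
      + (N b.src - ((bgUnits F K U' b : (Matrix (Fin 2) (Fin 2) ℂ)ˣ) : Matrix (Fin 2) (Fin 2) ℂ) * N b.tgt * (((bgUnits F K U' b)⁻¹ : (Matrix (Fin 2) (Fin 2) ℂ)ˣ) : Matrix (Fin 2) (Fin 2) ℂ))) :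
    ∃ β' : PBond (F.P K) 0 → Matrix (Fin 2) (Fin 2) ℂ, (∀ b, star (β' b) = -β' b ∧ (β' b).trace = 0) ∧ fderiv ℂ (logChartTwS F n K h U₀) A₁ β' = 0 ∧
      ∃ N' : Site (F.P K) 0 → Matrix (Fin 2) (Fin 2) ℂ, (∀ x, (N' x).IsHermitian ∧ (N' x).trace = 0) ∧
        ∀ b : PBond (F.P K) 0, ξ b = gSer ℂ (ad ℂ (-A₁ b)) (β' b)
          + (Complex.I • N' b.src - ((U' b : Matrix.specialUnitaryGroup (Fin 2) ℂ) : Matrix (Fin 2) (Fin 2) ℂ) * (Complex.I • N' b.tgt)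
              * star ((U' b : Matrix.specialUnitaryGroup (Fin 2) ℂ) : Matrix (Fin 2) (Fin 2) ℂ)) := by
  obtain ⟨hWl, hT⟩ := towerRows_at_of_regPr F hε₀ he hWe hWε U₀ hreg hA₁
  exact exists_su2_slice_tangent_add_gaugeDir_of_complex F h hε₀ he hWe hWε U₀ hreg hA₁ hA₁R hWl hT U' ξ hξ β N hβ hsplit

end Summit.QuantumFields.YangMills.Theorems.Prop7TwistedSliceGaugeOntoSU2

end
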